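import Summits.Langlands.Langlands.Theorems.IrreducibilityBySelfDualityHeckeEigenvalueFieldStubHullRelOpen
import Summits.Langlands.Langlands.Theorems.IrreducibilityBySelfDualityHeckeEigenvalueFieldStubHullPosDef
import Summits.Langlands.Langlands.Theorems.IrreducibilityBySelfDualityHeckeEigenvalueFieldStubSandwichIn
import Summits.Langlands.Langlands.Theorems.IrreducibilityBySelfDualityHeckeEigenvalueFieldStubSandwichOut
import Summits.Langlands.Langlands.Theorems.IrreducibilityBySelfDualityHeckeEigenvalueFieldStubAssemblyFinite
import Literature.NumberTheory.Automorphic.SiegelReducedFamiliesHull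
import Literature.NumberTheory.Automorphic.ArithmeticQuotientCohomologyFinite
import HarnessLib

/-!
# Borel–Serre finiteness for congruence subgroups of `GL_n` over number fields, FINITE coefficients
# (the named fact `BorelSerre1973_finite_groupCohomology_congruenceSubgroup` is a theorem)

Crux `HeckeEigenvalueField` (stmt-Langlands-13632), line `Sketch`.  The finite-coefficient assembly
`stub_borelSerre_assembly_finite` (landed) fed with the Hull Lemma
(`SiegelFamily.convexHull_isReduced_subset`, Literature), the relative openness and positivity of
Siegel-reduced families (`stub_hull_relOpen`, `stub_hull_posDef`) and the two halves of the sandwich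
of the archimedean Siegel domain (`stub_sandwich_in`, `stub_sandwich_out`) — all landed — gives the
named fact `BorelSerre1973_finite_groupCohomology_congruenceSubgroup` of
`ArithmeticQuotientCohomologyFinite` verbatim: for a number field `K`, a compact open
`U ≤ GL_n(𝔸_K^∞)` and a `ℤ[Γ_U]`-module `A` with finitely many elements, every `H^q(Γ_U, A)` is
finite.  (Consumers: `BigHeckeGLn.TameLevel.hidaCohomology_finite_of_borelSerre`, the
`ProModularOrdinaryClassical` exits of route `SkinnerWilesDefectOne`, the Bianchi finiteness crux.)
The field-coefficient sibling is `borelSerre1973_finiteDimensional_groupCohomology_congruenceSubgroup_holds`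
(`…HeckeEigenvalueFieldBorelSerre`).

## References

* A. Borel, J.-P. Serre, *Corners and arithmetic groups*, Comment. Math. Helv. 48 (1973), §11.1,
  Thm. 11.4.4 [BorelSerre1973].
* K. S. Brown, *Cohomology of Groups*, GTM 87 (1982), VII (7.10), VIII §2 [Brown1982CohomologyGroups].
-/

noncomputable section

set_option linter.dupNamespace false -- project-wide: `Summit.Langlands.Langlands` is the mandated namespace

open scoped Classical
open NumberField IsDedekindDomain CategoryTheory
open Literature.NumberTheory.Automorphic

namespace Summit.Langlands.Langlands.Theorems.HeckeEigenvalueField.Res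

open BigHeckeGLn

/-- **Named fact `BorelSerre1973_finite_groupCohomology_congruenceSubgroup` DISCHARGED**: for a
number field `K`, a compact open `U ≤ GL_n(𝔸_K^∞)` and a `ℤ[Γ_U]`-module `A` with finitely many
elements, every `H^q(Γ_U, A)` is finite — the finite-coefficient assembly
`stub_borelSerre_assembly_finite` fed with the Hull Lemma, the relative openness and positivity of
Siegel-reduced families and the two halves of the sandwich (all landed).
[cite: BorelSerre1973, §11.1, Thm. 11.4.4] [cite: Brown1982CohomologyGroups, VII (7.10); VIII §2] -/
theorem borelSerre1973_finite_groupCohomology_congruenceSubgroup_holds :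
    BorelSerre1973_finite_groupCohomology_congruenceSubgroup :=
  fun n K _ _ U hUo hUc A hA q =>
    stub_borelSerre_assembly_finite
      (fun ι m c C τ => SiegelFamily.convexHull_isReduced_subset (ι := ι) m c C τ)
      (fun ι _ m c C τ => stub_hull_relOpen ι m c C τ) stub_hull_posDef
      (fun n K _ _ Ω h₁ h₂ h₃ t ht => stub_sandwich_in n K Ω h₁ h₂ h₃ t ht)
      (fun n K _ _ c C τ => stub_sandwich_out n K c C τ) n K U hUo hUc A hA q

end Summit.Langlands.Langlands.Theorems.HeckeEigenvalueField.Res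

end
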